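import Summits.NavierStokesRegularity.NavierStokesRegularity.Theorems.GaldiLiouvilleGateCylinderBudgetsDefs
import Summits.NavierStokesRegularity.NavierStokesRegularity.Theorems.GaldiLiouvilleGateAllAxesBudgetCore
import Summits.NavierStokesRegularity.NavierStokesRegularity.Theorems.GaldiLiouvilleGateAllAxesLimitTools
import Summits.NavierStokesRegularity.NavierStokesRegularity.Theorems.GaldiLiouvilleGateAllAxesCylZones
import HarnessLib

/-!
# GaldiLiouvilleGateAllAxesCylinderBookkeeping — O1c′ `CylinderBookkeepingSplit` BY NAME (line «allaxes», ⟨0895⟩)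

The ONE-STROKE bookkeeping: from the fixed-cut-off inequality `core_axialEnergy_bound`
(`Theorems/GaldiLiouvilleGateAllAxesBudgetCore.lean`) remove the cut-offs in the order `Z → ∞`
(monotone convergence on the left; the `z`-collar error vanishes by (i) of `PressureCylinderDecay`),
`T → ∞` (the hoop tail `∫_{T<r≤2T}(u_θ/r)²` of a finite `swirlTail U t` vanishes; the pressure window
`T⁻²∫_{T<r≤2T}(c−P)` vanishes by (ii) and the two-window lemma), `ε → 0` (the transition annulus
`∫_{t<r≤t+ε}(c−P)` vanishes by (i); `(t+ε)² → t²`).  The sign `c − P ≥ 0` and the identification of the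
two pressure limits come from `HeadMaximumPrinciple`.  Result: `cylinderBookkeepingSplit_holds :
CylinderBookkeepingSplit` against the DEFS OF RECORD (`Theorems/GaldiLiouvilleGateCylinderBudgetsDefs.lean`).
No ⟨0895⟩/⟨0896⟩ claim and no NS-regularity statement is proved here. [folklore]
-/

noncomputable section

open MeasureTheory Set Filter Topology
open scoped ENNReal
open Literature.Analysis.FluidPDE

namespace Summit.NavierStokesRegularity.NavierStokesRegularity.Theorems.GaldiLiouville.AllAxesBudget

/-! ## The assembly -/

/-- O1c′ BY NAME: `PressureCylinderDecay → HeadMaximumPrinciple → CylinderBudget` for general smooth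
D-solutions (no symmetry) — the three cut-off removals applied to `core_axialEnergy_bound`. [folklore] -/
theorem cylinderBookkeepingSplit_holds : CylinderBookkeepingSplit := by
  intro hPCD hHMP ν hν U P hD t ht
  have hD' := hD
  obtain ⟨hprof, hU, hP, -, -⟩ := hD'
  obtain ⟨c, hPc, hQ⟩ := hHMP ν hν U P hD
  obtain ⟨c', hPc', hfin, hwin⟩ := hPCD ν hν U P hD
  have hcc : c' = c := tendsto_nhds_unique hPc' hPc
  subst hcc
  -- signs from the head principle
  have hcP : ∀ x, 0 ≤ c' - P x := fun x => by
    have h1 := hQ x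
    have h2 : 0 ≤ ‖U x‖ ^ 2 / 2 := by positivity
    linarith
  have habs : ∀ x, |P x - c'| = c' - P x := fun x => by
    rw [abs_sub_comm]; exact abs_of_nonneg (hcP x)
  simp only [habs] at hfin hwin
  -- the goal in the coordinates `s = x₀² + x₁²`
  unfold axialEnergyIn swirlTail
  rw [setOf_cylRadius_le_eq ht.le, setOf_lt_cylRadius_eq ht.le]
  simp only [axialVelocity]
  by_cases htop : (∫⁻ x in {x : EuclideanSpace ℝ (Fin 3) | t ^ 2 < x 0 ^ 2 + x 1 ^ 2}, swirlRateSq U x) = ⊤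
  · rw [htop, ENNReal.mul_top (ENNReal.ofReal_pos.2 (by positivity)).ne']
    exact le_top
  obtain ⟨K, hK0, hcore⟩ := core_axialEnergy_bound
  have hcoreU := hcore ν hν U P hprof hU hP c' hQ
  clear hcore
  simp only [ofReal_swirl_sq_div_eq_swirlRateSq] at hcoreU
  -- ### Step A: `Z → ∞` at fixed `ε, T`
  have hA : ∀ ε T : ℝ, 0 < ε → ε ≤ t → 2 * (t + ε) ≤ T →
      (∫⁻ x in {x : EuclideanSpace ℝ (Fin 3) | x 0 ^ 2 + x 1 ^ 2 ≤ t ^ 2}, ENNReal.ofReal (U x 2 ^ 2)) ≤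
        ENNReal.ofReal K *
            (∫⁻ x in {x : EuclideanSpace ℝ (Fin 3) | t ^ 2 < x 0 ^ 2 + x 1 ^ 2 ∧
                x 0 ^ 2 + x 1 ^ 2 ≤ (t + ε) ^ 2}, ENNReal.ofReal (c' - P x)) +
          ENNReal.ofReal ((t + ε) ^ 2) *
            (∫⁻ x in {x : EuclideanSpace ℝ (Fin 3) | t ^ 2 < x 0 ^ 2 + x 1 ^ 2}, swirlRateSq U x) +
          ENNReal.ofReal (K * (t + ε) ^ 2) *
            (∫⁻ x in {x : EuclideanSpace ℝ (Fin 3) | T ^ 2 < x 0 ^ 2 + x 1 ^ 2 ∧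
                x 0 ^ 2 + x 1 ^ 2 ≤ 4 * T ^ 2}, swirlRateSq U x) +
          ENNReal.ofReal (K * (t + ε) ^ 2 / T ^ 2) *
            (∫⁻ x in {x : EuclideanSpace ℝ (Fin 3) | T ^ 2 < x 0 ^ 2 + x 1 ^ 2 ∧
                x 0 ^ 2 + x 1 ^ 2 ≤ 4 * T ^ 2}, ENNReal.ofReal (c' - P x)) := by
    intro ε T hε hεt hT
    have hT0 : 0 < T := by linarith
    -- monotone convergence on the left
    have hSmono : Monotone (fun n : ℕ =>
        {x : EuclideanSpace ℝ (Fin 3) | x 0 ^ 2 + x 1 ^ 2 ≤ t ^ 2 ∧ |x 2| ≤ (n : ℝ)}) := by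
      intro n m hnm x hx
      simp only [mem_setOf_eq] at hx ⊢
      exact ⟨hx.1, hx.2.trans (Nat.cast_le.mpr hnm)⟩
    have hSU : (⋃ n : ℕ, {x : EuclideanSpace ℝ (Fin 3) | x 0 ^ 2 + x 1 ^ 2 ≤ t ^ 2 ∧ |x 2| ≤ (n : ℝ)}) =
        {x : EuclideanSpace ℝ (Fin 3) | x 0 ^ 2 + x 1 ^ 2 ≤ t ^ 2} := by
      ext x
      simp only [mem_iUnion, mem_setOf_eq]
      constructor
      · rintro ⟨n, h, -⟩; exact h
      · intro h; obtain ⟨n, hn⟩ := exists_nat_ge |x 2|; exact ⟨n, h, hn⟩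
    have hLHS : Tendsto (fun n : ℕ => ∫⁻ x in {x : EuclideanSpace ℝ (Fin 3) | x 0 ^ 2 + x 1 ^ 2 ≤ t ^ 2 ∧
        |x 2| ≤ (n : ℝ)}, ENNReal.ofReal (U x 2 ^ 2)) atTop
        (𝓝 (∫⁻ x in {x : EuclideanSpace ℝ (Fin 3) | x 0 ^ 2 + x 1 ^ 2 ≤ t ^ 2}, ENNReal.ofReal (U x 2 ^ 2))) := by
      rw [← hSU]; exact tendsto_setLIntegral_monotone hSmono
    -- the `z`-collar error vanishes
    have hEcol : Tendsto (fun n : ℕ => ∫⁻ x in {x : EuclideanSpace ℝ (Fin 3) | x 0 ^ 2 + x 1 ^ 2 ≤ 4 * T ^ 2 ∧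
        (n : ℝ) ≤ |x 2|}, ENNReal.ofReal (c' - P x)) atTop (𝓝 0) := by
      have hAfin : (∫⁻ x in {x : EuclideanSpace ℝ (Fin 3) | x 0 ^ 2 + x 1 ^ 2 ≤ 4 * T ^ 2},
          ENNReal.ofReal (c' - P x)) ≠ ⊤ :=
        ne_top_of_le_ne_top (hfin (2 * T + 1)).ne
          (lintegral_mono_set (setOf_sq_le_subset_cylRadius_lt hT0.le))
      have h := tendsto_setLIntegral_inter_antitone (μ := volume) hAfin
        (B := fun n : ℕ => {x : EuclideanSpace ℝ (Fin 3) | (n : ℝ) ≤ |x 2|})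
        (fun n m hnm x hx => by
          simp only [mem_setOf_eq] at hx ⊢
          exact le_trans (Nat.cast_le.mpr hnm) hx)
        (fun n => (measurableSet_sZone (n : ℝ) 0).2.2.2.1)
        (fun x => by
          obtain ⟨n, hn⟩ := exists_nat_gt |x 2|
          exact ⟨n, fun h => (not_le.2 hn) h⟩)
      exact h
    have hRHS := (tendsto_const_nhds (x := ENNReal.ofReal K *
            (∫⁻ x in {x : EuclideanSpace ℝ (Fin 3) | t ^ 2 < x 0 ^ 2 + x 1 ^ 2 ∧
                x 0 ^ 2 + x 1 ^ 2 ≤ (t + ε) ^ 2}, ENNReal.ofReal (c' - P x)) +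
          ENNReal.ofReal ((t + ε) ^ 2) *
            (∫⁻ x in {x : EuclideanSpace ℝ (Fin 3) | t ^ 2 < x 0 ^ 2 + x 1 ^ 2}, swirlRateSq U x) +
          ENNReal.ofReal (K * (t + ε) ^ 2) *
            (∫⁻ x in {x : EuclideanSpace ℝ (Fin 3) | T ^ 2 < x 0 ^ 2 + x 1 ^ 2 ∧
                x 0 ^ 2 + x 1 ^ 2 ≤ 4 * T ^ 2}, swirlRateSq U x) +
          ENNReal.ofReal (K * (t + ε) ^ 2 / T ^ 2) *
            (∫⁻ x in {x : EuclideanSpace ℝ (Fin 3) | T ^ 2 < x 0 ^ 2 + x 1 ^ 2 ∧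
                x 0 ^ 2 + x 1 ^ 2 ≤ 4 * T ^ 2}, ENNReal.ofReal (c' - P x))) (f := (atTop : Filter ℕ))).add
      (ENNReal.Tendsto.const_mul hEcol (Or.inr (ENNReal.ofReal_ne_top (r := K * (T ^ 2 + T)))))
    rw [mul_zero, add_zero] at hRHS
    refine le_of_tendsto_of_tendsto hLHS hRHS (Eventually.of_forall fun n => ?_)
    beta_reduce
    have h := hcoreU t ε T n hε hεt hT (Nat.cast_nonneg n)
    have hI₂ : (∫⁻ x in {x : EuclideanSpace ℝ (Fin 3) | (t + ε) ^ 2 < x 0 ^ 2 + x 1 ^ 2 ∧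
        x 0 ^ 2 + x 1 ^ 2 ≤ T ^ 2}, swirlRateSq U x) ≤
        ∫⁻ x in {x : EuclideanSpace ℝ (Fin 3) | t ^ 2 < x 0 ^ 2 + x 1 ^ 2}, swirlRateSq U x := by
      refine lintegral_mono_set fun x hx => ?_
      simp only [mem_setOf_eq] at hx ⊢
      nlinarith [hx.1]
    exact h.trans (by gcongr)
  -- ### Step B: `T → ∞` at fixed `ε`
  have hB : ∀ ε : ℝ, 0 < ε → ε ≤ t →
      (∫⁻ x in {x : EuclideanSpace ℝ (Fin 3) | x 0 ^ 2 + x 1 ^ 2 ≤ t ^ 2}, ENNReal.ofReal (U x 2 ^ 2)) ≤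
        ENNReal.ofReal K *
            (∫⁻ x in {x : EuclideanSpace ℝ (Fin 3) | t ^ 2 < x 0 ^ 2 + x 1 ^ 2 ∧
                x 0 ^ 2 + x 1 ^ 2 ≤ (t + ε) ^ 2}, ENNReal.ofReal (c' - P x)) +
          ENNReal.ofReal ((t + ε) ^ 2) *
            (∫⁻ x in {x : EuclideanSpace ℝ (Fin 3) | t ^ 2 < x 0 ^ 2 + x 1 ^ 2}, swirlRateSq U x) := by
    intro ε hε hεt
    -- the hoop tail beyond `T` vanishes
    have h3 : Tendsto (fun n : ℕ => ∫⁻ x in {x : EuclideanSpace ℝ (Fin 3) | ((n : ℕ) : ℝ) ^ 2 < x 0 ^ 2 + x 1 ^ 2 ∧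
        x 0 ^ 2 + x 1 ^ 2 ≤ 4 * ((n : ℕ) : ℝ) ^ 2}, swirlRateSq U x) atTop (𝓝 0) := by
      have h := tendsto_setLIntegral_inter_antitone (μ := volume) (f := fun x => swirlRateSq U x) htop
        (B := fun n : ℕ => {x : EuclideanSpace ℝ (Fin 3) | (n : ℝ) ^ 2 < x 0 ^ 2 + x 1 ^ 2})
        (fun n m hnm x hx => by
          simp only [mem_setOf_eq] at hx ⊢
          have : (n : ℝ) ^ 2 ≤ (m : ℝ) ^ 2 :=
            pow_le_pow_left₀ n.cast_nonneg (Nat.cast_le.mpr hnm) 2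
          exact lt_of_le_of_lt this hx)
        (fun n => (measurableSet_sZone ((n : ℝ) ^ 2) 0).2.2.1)
        (fun x => by
          obtain ⟨n, hn⟩ := exists_nat_ge (x 0 ^ 2 + x 1 ^ 2 + 1)
          refine ⟨n, fun h => ?_⟩
          simp only [mem_setOf_eq] at h
          have hs0 : 0 ≤ x 0 ^ 2 + x 1 ^ 2 := by positivity
          have hn1 : (1 : ℝ) ≤ n := by linarith
          nlinarith [mul_nonneg (by linarith : (0 : ℝ) ≤ (n : ℝ)) (by linarith : (0 : ℝ) ≤ (n : ℝ) - 1)])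
      refine tendsto_of_tendsto_of_tendsto_of_le_of_le' tendsto_const_nhds h
        (Eventually.of_forall fun n => bot_le) ?_
      filter_upwards [eventually_ge_atTop ⌈t⌉₊] with n hn
      have htn : t ≤ (n : ℝ) := (Nat.le_ceil t).trans (by exact_mod_cast hn)
      refine lintegral_mono_set fun x hx => ?_
      simp only [mem_setOf_eq, mem_inter_iff] at hx ⊢
      exact ⟨by nlinarith [hx.1], hx.1⟩
    -- the pressure window vanishes by (ii)
    have h4R : Tendsto (fun R : ℝ => ENNReal.ofReal (K * (t + ε) ^ 2 / R ^ 2) *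
        ∫⁻ x in {x : EuclideanSpace ℝ (Fin 3) | R ^ 2 < x 0 ^ 2 + x 1 ^ 2 ∧ x 0 ^ 2 + x 1 ^ 2 ≤ 4 * R ^ 2},
          ENNReal.ofReal (c' - P x)) atTop (𝓝 0) := by
      refine tendsto_closedWindow_of_openWindow (by positivity) (hwin.congr' ?_)
      filter_upwards [eventually_ge_atTop (0 : ℝ)] with R hR
      rw [setOf_window_eq hR]
    have h4 := h4R.comp tendsto_natCast_atTop_atTop
    have hRHS := ((tendsto_const_nhds (x := ENNReal.ofReal K *
            (∫⁻ x in {x : EuclideanSpace ℝ (Fin 3) | t ^ 2 < x 0 ^ 2 + x 1 ^ 2 ∧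
                x 0 ^ 2 + x 1 ^ 2 ≤ (t + ε) ^ 2}, ENNReal.ofReal (c' - P x)) +
          ENNReal.ofReal ((t + ε) ^ 2) *
            (∫⁻ x in {x : EuclideanSpace ℝ (Fin 3) | t ^ 2 < x 0 ^ 2 + x 1 ^ 2}, swirlRateSq U x))
          (f := (atTop : Filter ℕ))).add
      (ENNReal.Tendsto.const_mul h3 (Or.inr (ENNReal.ofReal_ne_top (r := K * (t + ε) ^ 2))))).add h4
    rw [mul_zero, add_zero, add_zero] at hRHS
    refine ge_of_tendsto hRHS ?_
    filter_upwards [eventually_ge_atTop ⌈2 * (t + ε)⌉₊] with n hn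
    have hTn : 2 * (t + ε) ≤ (n : ℝ) := (Nat.le_ceil _).trans (by exact_mod_cast hn)
    exact hA ε n hε hεt hTn
  -- ### Step C: `ε → 0` along `ε_n = t/(n+1)`
  have hεn : ∀ n : ℕ, 0 < t / ((n : ℝ) + 1) ∧ t / ((n : ℝ) + 1) ≤ t := fun n =>
    ⟨by positivity, div_le_self ht.le (by linarith [n.cast_nonneg (α := ℝ)])⟩
  have h1 : Tendsto (fun n : ℕ => ∫⁻ x in {x : EuclideanSpace ℝ (Fin 3) | t ^ 2 < x 0 ^ 2 + x 1 ^ 2 ∧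
      x 0 ^ 2 + x 1 ^ 2 ≤ (t + t / ((n : ℝ) + 1)) ^ 2}, ENNReal.ofReal (c' - P x)) atTop (𝓝 0) := by
    have hAfin : (∫⁻ x in {x : EuclideanSpace ℝ (Fin 3) | x 0 ^ 2 + x 1 ^ 2 < (2 * t + 1) ^ 2},
        ENNReal.ofReal (c' - P x)) ≠ ⊤ := by
      rw [← setOf_cylRadius_lt_eq (by positivity)]; exact (hfin _).ne
    have h := tendsto_setLIntegral_inter_antitone (μ := volume) hAfin
      (B := fun n : ℕ => {x : EuclideanSpace ℝ (Fin 3) | t ^ 2 < x 0 ^ 2 + x 1 ^ 2 ∧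
        x 0 ^ 2 + x 1 ^ 2 ≤ (t + t / ((n : ℝ) + 1)) ^ 2})
      (fun n m hnm x hx => by
        simp only [mem_setOf_eq] at hx ⊢
        refine ⟨hx.1, hx.2.trans ?_⟩
        have hmn : t / ((m : ℝ) + 1) ≤ t / ((n : ℝ) + 1) :=
          div_le_div_of_nonneg_left ht.le (by positivity) (by simpa using hnm)
        have h0 : 0 ≤ t + t / ((m : ℝ) + 1) := by positivity
        nlinarith)
      (fun n => (measurableSet_sZone (t ^ 2) ((t + t / ((n : ℝ) + 1)) ^ 2)).1)
      (fun x => by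
        by_cases hs : x 0 ^ 2 + x 1 ^ 2 ≤ t ^ 2
        · exact ⟨0, fun h => absurd h.1 (not_lt.2 hs)⟩
        · push Not at hs
          obtain ⟨n, hn⟩ := exists_nat_gt (3 * t ^ 2 / (x 0 ^ 2 + x 1 ^ 2 - t ^ 2))
          refine ⟨n, fun h => ?_⟩
          simp only [mem_setOf_eq] at h
          have hδ := hεn n
          have hpos : 0 < x 0 ^ 2 + x 1 ^ 2 - t ^ 2 := sub_pos.2 hs
          have hkey : 3 * t ^ 2 < (x 0 ^ 2 + x 1 ^ 2 - t ^ 2) * ((n : ℝ) + 1) := by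
            have := (div_lt_iff₀ hpos).1 hn
            nlinarith
          have hexp : (t + t / ((n : ℝ) + 1)) ^ 2 ≤ t ^ 2 + 3 * t * (t / ((n : ℝ) + 1)) := by
            nlinarith [hδ.1, hδ.2]
          have h3t : 3 * t * (t / ((n : ℝ) + 1)) * ((n : ℝ) + 1) = 3 * t ^ 2 := by
            field_simp
          nlinarith [h.2, mul_le_mul_of_nonneg_right (h.2.trans hexp) (by positivity : (0:ℝ) ≤ (n:ℝ) + 1)])
    refine h.congr' (Eventually.of_forall fun n => ?_)
    show (∫⁻ x in _ ∩ _, ENNReal.ofReal (c' - P x)) = _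
    rw [inter_eq_right.2]
    intro x hx
    simp only [mem_setOf_eq] at hx ⊢
    nlinarith [hx.2, (hεn n).1, (hεn n).2]
  have h2 : Tendsto (fun n : ℕ => ENNReal.ofReal ((t + t / ((n : ℝ) + 1)) ^ 2)) atTop
      (𝓝 (ENNReal.ofReal (t ^ 2))) := by
    refine ENNReal.tendsto_ofReal ?_
    have h0 : Tendsto (fun n : ℕ => t / ((n : ℝ) + 1)) atTop (𝓝 0) := by
      have h := (tendsto_one_div_add_atTop_nhds_zero_nat).const_mul t
      rw [mul_zero] at h
      exact h.congr fun n => by ring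
    have h := ((tendsto_const_nhds (x := t)).add h0).pow 2
    rw [add_zero] at h
    exact h
  have hRHS := (ENNReal.Tendsto.const_mul h1 (Or.inr (ENNReal.ofReal_ne_top (r := K)))).add
    (ENNReal.Tendsto.mul_const h2 (Or.inr htop))
  rw [mul_zero, zero_add] at hRHS
  exact ge_of_tendsto hRHS (Eventually.of_forall fun n => hB _ (hεn n).1 (hεn n).2)

end Summit.NavierStokesRegularity.NavierStokesRegularity.Theorems.GaldiLiouville.AllAxesBudget
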